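import Literature.NumberTheory.EllipticCurves.QuadraticTwistMinimalModelProofs
import Literature.NumberTheory.EllipticCurves.QuadraticTwistTateFormTwoProofs
import Literature.NumberTheory.EllipticCurves.BSDSelmerPConverseRamifiedProofs
import Literature.NumberTheory.EllipticCurves.RootNumberProofs
import Literature.NumberTheory.EllipticCurves.SzpiroLocalDataProofs
import Literature.NumberTheory.EllipticCurves.GlobalMinimalModel
import Literature.NumberTheory.DiophantineGeometry.MinimalDiscriminantFactorizationProofs
import Literature.NumberTheory.DiophantineGeometry.MinimalDiscriminantSmulProofs
import Literature.NumberTheory.DiophantineGeometry.MinimalDiscriminantProofs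
import Literature.NumberTheory.DiophantineGeometry.EllArithGlueProofs
import Literature.NumberTheory.DiophantineGeometry.TateAlgorithmProofs
import Literature.NumberTheory.DiophantineGeometry.Conductor
import Literature.NumberTheory.EllipticCurves.Rank1Residual.Predicates
import Summits.BirchSwinnertonDyer.Rank1Residual.Additive.QuadraticTwistSurj
import HarnessLib

/-!
# The twist by `p* ≡ 1 (mod 4)` is unramified away from `p`: (ram) and multiplicative primes transport, so `surj(p) ∧ ram(p)` on `E` gives the `p`-adic surjectivity of `E♭` (cell `b2b-bsdres`, seat additive-p4, line V9e)

HONEST FRAMING (cell `b2b-bsdres`, run/shared/lean/b2b/bsd-rank1-residual/, verbatim in every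
file): the goal of the cell is to DELETE the COMBINATION-SHAPED residual classes of the
Birch–Swinnerton-Dyer formula for ALL analytic-rank `≤ 1` elliptic curves over `ℚ` — "full BSD
formula for every rank `≤ 1` curve in class `C`" assembled STRICTLY from published theorems — so
that the rank-`≤ 1` remainder becomes exactly the CONSTRUCTION-SHAPED classes, which are TYPED
(missing-input `Prop`s), NOT attempted. This is not "finishing BSD". The additive sub-cell (seats
additive-p1…p4) is a RESEARCH ROUTE on the construction-shaped classes X3/X4; no claim beyond the
stated classes; the labels of X3/X4 are UNCHANGED.

Theorems only (no definition, no named fact). Item V9e of the seat's repair census: the X4 odd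
assembly (`X4RankZeroTwistOdd.*`, p204500) needs the `p`-ADIC surjectivity of the semistable twist
`V = E♭` (`∀ n, ρ̄_{V,pⁿ}` onto). For `p ≥ 5` that is Serre's lemma from `surj(p)`; for EVERY `p`
(so for `p = 3`, the census prime) the tree proves it from `surj(p)` and a multiplicative prime
`ℓ ≠ p` with `p ∤ v_ℓ(Δ_min)` (`hasSurjectiveModNGaloisRep_pow_of_hasMultiplicativeReductionAtPrime`,
BSTW 2024 (ram)). Both data are given on `E`, not on `E♭`; this file transports them. The twist
`E ≅ V^{(d)}` with `d = p* = 4k + 1` (`p* = p` if `p ≡ 1 (mod 4)`, `−p` if `p ≡ 3 (mod 4)`) is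
UNRAMIFIED at every prime `ℓ ≠ p` (`k ∈ ℤ`, `4k + 1` an `ℓ`-unit, `ℓ = 2` included), so by the
tree's unramified-twist invariance of Tate's algorithm (`kodairaSymbolAt_twistModel`,
`ordMinimalDiscriminant_twistModel`, Comalada 1994 §2):

* `kodairaSymbolAt_eq_of_twist_pStar`, `ordMinimalDiscriminant_eq_of_twist_pStar` — at a place
  `v ∤ p` of `ℤ`, `W ≅ V^{(4k+1)}` with `v(4k+1) = 1`: same Kodaira symbol, same `ord_v Δ_min`;
* `mult_iff_of_twist_pStar`, `padicValInt_minimalDiscriminantInt_eq_of_twist_pStar` — hence for a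
  prime `ℓ ≠ p`: `Mult W ℓ ↔ Mult V ℓ` and `v_ℓ(Δ_min(W)) = v_ℓ(Δ_min(V))` (globally minimal `W`,
  `V`; bridges `kodairaSymbolAt_eq_I_iff_holds`, `factorization_minimalDiscriminantNorm_holds`);
* `ram_of_twist_pStar` — `Ram W p → Ram V p`;
* `forall_surj_pow_of_twist_pStar_of_surj_of_ram` — **`surj(p) ∧ ram(p)` for `E` ⇒
  `∀ n, ρ̄_{E♭,pⁿ}` onto**, every `p` (mod-`p` surjectivity is a twist invariant: additive-p2's
  `surj_iff_of_model_twist`, p204512).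

References: [SilvermanATAEC1994] IV.9.4; [SilvermanAEC2009] VII.1 Prop. 1.3; S. Comalada, J. Number
Theory 49 (1994) §2; [BurungaleSkinnerTianWan2024] (ram); [SerreAbelianLadic1968] IV §3.4.
-/

noncomputable section

open scoped Classical

open IsDedekindDomain IsDedekindDomain.HeightOneSpectrum Rat.HeightOneSpectrum WeierstrassCurve
  Literature.NumberTheory.EllipticCurves Literature.NumberTheory.EllipticCurves.Rank1Residual

namespace Summit.BirchSwinnertonDyer.Rank1Residual.Additive

section Transport

variable (V : WeierstrassCurve ℚ) [V.IsElliptic] {W : WeierstrassCurve ℚ}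

/-- **Same Kodaira symbol at `v ∤ (4k+1)`** for any equation `W ≅ V^{(4k+1)}`, `k ∈ ℤ`: the
twisted equation is `ℚ`-isomorphic to the integral twist model `V.twistModel k`
(`exists_variableChange_twistModel_eq_quadraticTwist`), whose Kodaira symbol at a place where `k` is
integral and `4k + 1` a unit is that of `V` (`kodairaSymbolAt_twistModel`); Kodaira symbols are
isomorphism invariants (`kodairaSymbolAt_smul'`). [cite: SilvermanATAEC1994, IV.9.4 (PDF pp. 344–346)] -/
theorem kodairaSymbolAt_eq_of_twist_pStar (v : HeightOneSpectrum ℤ) {k : ℤ}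
    (hd : v.valuation ℚ ((4 * k + 1 : ℤ) : ℚ) = 1) (C : VariableChange ℚ)
    (hW : C • V.quadraticTwist ((4 * k + 1 : ℤ) : ℚ) = W) :
    W.kodairaSymbolAt v = V.kodairaSymbolAt v := by
  haveI : PerfectField (IsLocalRing.ResidueField (v.adicCompletionIntegers ℚ)) := PerfectField.ofFinite
  obtain ⟨C', -, hC'⟩ := exists_variableChange_twistModel_eq_quadraticTwist V (k : ℚ)
  have hk : v.valuation ℚ (k : ℚ) ≤ 1 := by
    rw [show (k : ℚ) = algebraMap ℤ ℚ k from (eq_intCast _ k).symm]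
    exact v.valuation_le_one k
  have hd' : v.valuation ℚ (4 * (k : ℚ) + 1) = 1 := by exact_mod_cast hd
  have hWm : W = (C * C') • V.twistModel (k : ℚ) := by
    rw [mul_smul, hC', ← hW]; push_cast; ring_nf
  haveI : (V.twistModel (k : ℚ)).IsElliptic := by
    have h0 : (4 * (k : ℚ) + 1) ≠ 0 := by
      intro h; rw [h, map_zero] at hd'; exact zero_ne_one hd'
    haveI := V.isElliptic_quadraticTwist h0
    have : C'⁻¹ • V.quadraticTwist (4 * (k : ℚ) + 1) = V.twistModel (k : ℚ) := by
      rw [← hC', smul_smul, inv_mul_cancel, one_smul]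
    rw [← this]; infer_instance
  rw [hWm, kodairaSymbolAt_smul', kodairaSymbolAt_twistModel v V hk hd']

/-- **Same `ord_v Δ_min` at `v ∤ (4k+1)`** for any equation `W ≅ V^{(4k+1)}` (`ordMinimalDiscriminant_twistModel`,
`ordMinimalDiscriminant_smul_holds`). [cite: SilvermanAEC2009, VII.1 Prop. 1.3] -/
theorem ordMinimalDiscriminant_eq_of_twist_pStar (v : HeightOneSpectrum ℤ) {k : ℤ}
    (hd : v.valuation ℚ ((4 * k + 1 : ℤ) : ℚ) = 1) (C : VariableChange ℚ)
    (hW : C • V.quadraticTwist ((4 * k + 1 : ℤ) : ℚ) = W) :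
    W.ordMinimalDiscriminant v = V.ordMinimalDiscriminant v := by
  obtain ⟨C', -, hC'⟩ := exists_variableChange_twistModel_eq_quadraticTwist V (k : ℚ)
  have hk : v.valuation ℚ (k : ℚ) ≤ 1 := by
    rw [show (k : ℚ) = algebraMap ℤ ℚ k from (eq_intCast _ k).symm]
    exact v.valuation_le_one k
  have hd' : v.valuation ℚ (4 * (k : ℚ) + 1) = 1 := by exact_mod_cast hd
  have hWm : W = (C * C') • V.twistModel (k : ℚ) := by
    rw [mul_smul, hC', ← hW]; push_cast; ring_nf
  haveI : (V.twistModel (k : ℚ)).IsElliptic := by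
    have h0 : (4 * (k : ℚ) + 1) ≠ 0 := by
      intro h; rw [h, map_zero] at hd'; exact zero_ne_one hd'
    haveI := V.isElliptic_quadraticTwist h0
    have : C'⁻¹ • V.quadraticTwist (4 * (k : ℚ) + 1) = V.twistModel (k : ℚ) := by
      rw [← hC', smul_smul, inv_mul_cancel, one_smul]
    rw [← this]; infer_instance
  rw [hWm, ordMinimalDiscriminant_smul_holds v (V.twistModel (k : ℚ)) (C * C'),
    ordMinimalDiscriminant_twistModel v V hk hd']

end Transport

section Primes

variable (p : ℕ) [hp : Fact p.Prime] (V : WeierstrassCurve ℚ) [V.IsElliptic] [V.IsGloballyMinimal]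
  {W : WeierstrassCurve ℚ} [W.IsElliptic] [W.IsGloballyMinimal]

omit [V.IsElliptic] [V.IsGloballyMinimal] [W.IsElliptic] [W.IsGloballyMinimal] in
/-- At the place of `ℤ` over a prime `ℓ ≠ p`, `p* = ±p` is a unit. -/
private theorem valuation_pm_p_eq_one_of_ne {ℓ : ℕ} (hℓ : ℓ.Prime) (hℓp : ℓ ≠ p) {d : ℤ}
    (hdp : d = p ∨ d = -p) :
    ((primesEquiv (R := ℤ)).symm ⟨ℓ, hℓ⟩).valuation ℚ (d : ℚ) = 1 := by
  rw [Literature.NumberTheory.EllipticCurves.Rat.valuation_intCast_eq_one_iff,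
    show natGenerator ((primesEquiv (R := ℤ)).symm ⟨ℓ, hℓ⟩) = ℓ from
      congrArg Subtype.val ((primesEquiv (R := ℤ)).apply_symm_apply ⟨ℓ, hℓ⟩)]
  have hℓZ : Prime (ℓ : ℤ) := Nat.prime_iff_prime_int.mp hℓ
  have h : ¬ (ℓ : ℤ) ∣ (p : ℤ) := fun h ↦ hℓp
    ((Nat.prime_dvd_prime_iff_eq hℓ hp.out).mp (Int.natCast_dvd_natCast.mp h))
  rcases hdp with rfl | rfl
  · exact h
  · rwa [dvd_neg]

omit [V.IsGloballyMinimal] [W.IsGloballyMinimal] in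
/-- **`Mult W ℓ ↔ Mult V ℓ` at every prime `ℓ ≠ p`** for `W ≅ V^{(d)}`, `d = ±p = 4k + 1`
(i.e. `d = p*`): the twist is unramified at `ℓ`, the Kodaira symbols at `ℓ` agree
(`kodairaSymbolAt_eq_of_twist_pStar`), and multiplicative reduction is "Kodaira symbol `Iₙ`, `n ≥ 1`"
(`kodairaSymbolAt_eq_I_iff_holds`, `ordMinimalDiscriminant_eq_zero_iff_holds`).
[cite: SilvermanAEC2009, VII.5 Prop. 5.1(b)] -/
theorem mult_iff_of_twist_pStar {d k : ℤ} (hdk : d = 4 * k + 1) (hdp : d = p ∨ d = -p)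
    (C : VariableChange ℚ) (hW : C • V.quadraticTwist (d : ℚ) = W) {ℓ : ℕ} [hℓ : Fact ℓ.Prime]
    (hℓp : ℓ ≠ p) : Mult W ℓ ↔ Mult V ℓ := by
  set v : HeightOneSpectrum ℤ := (primesEquiv (R := ℤ)).symm ⟨ℓ, hℓ.out⟩ with hvdef
  have hdv : v.valuation ℚ ((4 * k + 1 : ℤ) : ℚ) = 1 := by
    rw [← hdk]; exact valuation_pm_p_eq_one_of_ne p hℓ.out hℓp hdp
  subst hdk
  have hK := kodairaSymbolAt_eq_of_twist_pStar V v hdv C hW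
  have hO := ordMinimalDiscriminant_eq_of_twist_pStar V v hdv C hW
  -- `Mult X ℓ ↔ X` multiplicative at `v` ↔ `X.kodairaSymbolAt v = I n`, `n = ord_v Δ_min ≥ 1`
  have key : ∀ (X : WeierstrassCurve ℚ) [X.IsElliptic],
      Mult X ℓ ↔ ∃ n : ℕ, n ≠ 0 ∧ X.kodairaSymbolAt v = .I n := by
    intro X _
    rw [show Mult X ℓ ↔ X.HasMultiplicativeReductionAt v from
      X.hasMultiplicativeReductionAtPrime_iff_hasMultiplicativeReductionAt_holds ⟨ℓ, hℓ.out⟩]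
    constructor
    · intro hm
      have hn : X.ordMinimalDiscriminant v ≠ 0 := fun h0 ↦
        hm.not_hasGoodReductionAt ((ordMinimalDiscriminant_eq_zero_iff_holds v X).mp h0)
      exact ⟨_, hn, (kodairaSymbolAt_eq_I_iff_holds v X hn).mpr ⟨hm, rfl⟩⟩
    · rintro ⟨n, hn, hk⟩
      exact ((kodairaSymbolAt_eq_I_iff_holds v X hn).mp hk).1
  rw [key W, key V, hK]

/-- **`v_ℓ(Δ_min(W)) = v_ℓ(Δ_min(V))` at every prime `ℓ ≠ p`** for globally minimal `W ≅ V^{(p*)}`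
(`ordMinimalDiscriminant_eq_of_twist_pStar` read through `factorization_minimalDiscriminantNorm_holds`
and `minimalDiscriminantNorm_int_eq_natAbs_minimalDiscriminantInt_holds`).
[cite: SilvermanAEC2009, VIII.8 (minimal discriminant) and VII.1 Prop. 1.3] -/
theorem padicValInt_minimalDiscriminantInt_eq_of_twist_pStar {d k : ℤ} (hdk : d = 4 * k + 1)
    (hdp : d = p ∨ d = -p) (C : VariableChange ℚ) (hW : C • V.quadraticTwist (d : ℚ) = W) {ℓ : ℕ}
    [hℓ : Fact ℓ.Prime] (hℓp : ℓ ≠ p) :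
    padicValInt ℓ W.minimalDiscriminantInt = padicValInt ℓ V.minimalDiscriminantInt := by
  set v : HeightOneSpectrum ℤ := (primesEquiv (R := ℤ)).symm ⟨ℓ, hℓ.out⟩ with hvdef
  have hgen : natGenerator v = ℓ := congrArg Subtype.val ((primesEquiv (R := ℤ)).apply_symm_apply ⟨ℓ, hℓ.out⟩)
  have hdv : v.valuation ℚ ((4 * k + 1 : ℤ) : ℚ) = 1 := by
    rw [← hdk]; exact valuation_pm_p_eq_one_of_ne p hℓ.out hℓp hdp
  subst hdk
  have hO := ordMinimalDiscriminant_eq_of_twist_pStar V v hdv C hW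
  have bridge : ∀ (X : WeierstrassCurve ℚ) [X.IsElliptic] [X.IsGloballyMinimal],
      padicValInt ℓ X.minimalDiscriminantInt = X.ordMinimalDiscriminant v := by
    intro X _ _
    have h1 := X.factorization_minimalDiscriminantNorm_holds v
    rw [hgen, minimalDiscriminantNorm_int_eq_natAbs_minimalDiscriminantInt_holds X,
      Nat.factorization_def _ hℓ.out] at h1
    rw [← h1]
    rfl
  rw [bridge W, bridge V, hO]

/-- **(ram) transports to the twist**: `Ram W p → Ram V p` for globally minimal `W ≅ V^{(p*)}`. -/
theorem ram_of_twist_pStar {d k : ℤ} (hdk : d = 4 * k + 1) (hdp : d = p ∨ d = -p)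
    (C : VariableChange ℚ) (hW : C • V.quadraticTwist (d : ℚ) = W) (hram : Ram W p) : Ram V p := by
  obtain ⟨ℓ, hℓ, hℓp, hmult, hv⟩ := hram
  refine ⟨ℓ, hℓ, hℓp, (mult_iff_of_twist_pStar p V hdk hdp C hW hℓp).mp hmult, ?_⟩
  rwa [← padicValInt_minimalDiscriminantInt_eq_of_twist_pStar p V hdk hdp C hW hℓp]

/-- **`surj(p) ∧ ram(p)` on `E` give the `p`-adic surjectivity of `E♭`**, for EVERY prime `p`
(`p = 3` included): `W ≅ V^{(p*)}`, `p* = ±p = 4k + 1`, `W`, `V` globally minimal, `ρ̄_{W,p}` onto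
and (ram) for `W` ⇒ `ρ̄_{V,pⁿ}` onto for all `n` (transport + the tree's
`hasSurjectiveModNGaloisRep_pow_of_hasMultiplicativeReductionAtPrime`).
[cite: BurungaleSkinnerTianWan2024, Thm. 1.10 and Part II (sur), (ram) (p. 74)]
[cite: SerreAbelianLadic1968, Ch. IV §3.4 and A.1.2] -/
theorem forall_surj_pow_of_twist_pStar_of_surj_of_ram {d k : ℤ} (hdk : d = 4 * k + 1)
    (hdp : d = p ∨ d = -p) (C : VariableChange ℚ) (hW : C • V.quadraticTwist (d : ℚ) = W)
    (hsurj : Surj W p) (hram : Ram W p) (n : ℕ) : V.HasSurjectiveModNGaloisRep (p ^ n : ℕ) := by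
  have hd0 : (d : ℚ) ≠ 0 := by
    rcases hdp with rfl | rfl <;> simp [hp.out.ne_zero]
  exact hasSurjectiveModNGaloisRep_pow_of_hasMultiplicativeReductionAtPrime V p
    ((surj_iff_of_model_twist V p hd0 ⟨C, hW⟩).mp hsurj) (ram_of_twist_pStar p V hdk hdp C hW hram) n

end Primes

end Summit.BirchSwinnertonDyer.Rank1Residual.Additive

end
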